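import Mathlib
import Summits.ValiantsHypothesis.ValiantsHypothesis.Theorems.LacunarySymmetroidMatrixDescartesInertiaIndexFormula

/-!
# `MatrixDescartes` (stmt-ValiantsHypothesis-18050) — INERTIA KIT, IV-i: THE REVIVAL LEMMA — a positive-type root whose kernel
# vector's Rayleigh `K`-nomial is positive somewhere to its left forces an EARLIER positive root of that `K`-nomial, hence at least
# TWO sign variations in its coefficient sequence `(uᵀSₖu)ₖ` (Descartes); every symmetric lacunary pencil, every format

HONEST FRAMING.  Cell `pub-symmetroid`, seat `val-sym-mdr-p2` (gen 17); helper file `--supports` the crux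
`Theses.LacunarySymmetroid.MatrixDescartes`, NO closure claim.  The structural fact behind the GLOBAL INDEX FORMULA's reading «every
positive root beyond the inertia budget `m` is paid for by a revival»: revivals (up-crossings) need Rayleigh `K`-nomials with at least
two sign variations that have ALREADY vanished once.  Nothing here bears on the crux in its window, on `stub_twoSided`, on
`DoorA26`/`DoorA34`, registers, or `VP ≠ VNP`.

CONTENT.  §1 scalar: `exists_root_before_of_upcrossing` (`f(a) > 0`, `a < t`, `f(t) = 0`, `f′(t) > 0` ⇒ a root of `f` in `(a, t)`:
the factor `f = (X − t)q` with `q(t) = f′(t) > 0` makes `f < 0` just left of `t`, then the intermediate value theorem),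
`two_le_countP_roots_pos_of_upcrossing` (with `0 < a`: at least two positive roots counted with multiplicity) and
`two_le_signVariations_of_upcrossing` (Mathlib's Descartes rule `Polynomial.roots_countP_pos_le_signVariations`).  §2 pencil:
`revival_lemma` — at a positive root `t` of `det F`, a kernel vector `u ≠ 0` with `P_u′(t) > 0` (`P_u = ∑ₖ (uᵀSₖu)X^{dₖ}`) and
`P_u(a) > 0` at some scale `0 < a < t` forces a root of `P_u` in `(a, t)` and `signVariations P_u ≥ 2`.  Contrapositive reading: if
every Rayleigh `K`-nomial that is positive near `0⁺` has at most one sign variation, no positive root is of positive type (cf. the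
Loewner / `V ≤ 1` sectors of the tree, `…LoewnerSector`). [folklore]; axioms standard; no definitions.
-/

-- layout Summits/ValiantsHypothesis/ValiantsHypothesis forces the duplicated namespace component
set_option linter.dupNamespace false

namespace Summit.ValiantsHypothesis.ValiantsHypothesis.Theorems.LacunarySymmetroidMatrixDescartes

open Matrix Finset Polynomial
open scoped BigOperators Topology

namespace Inertia

/-! ## §1 Up-crossings of a real polynomial -/

/-- **An up-crossing after a positive value forces an earlier root.**  `a < t`, `f(a) > 0`, `f(t) = 0`, `f′(t) > 0` ⇒ `f` has a root
in `(a, t)`. [folklore] -/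
theorem exists_root_before_of_upcrossing (f : ℝ[X]) {a t : ℝ} (hat : a < t) (hfa : 0 < f.eval a) (hroot : f.eval t = 0)
    (hup : 0 < (derivative f).eval t) : ∃ s, a < s ∧ s < t ∧ f.eval s = 0 := by
  -- `f < 0` somewhere in `(a, t)`: otherwise `f ≥ 0` on `(a, t)`... use the factorisation directly
  have hf : (X - C t) * (f /ₘ (X - C t)) = f := mul_divByMonic_eq_iff_isRoot.2 hroot
  set q := f /ₘ (X - C t) with hq
  have hqt : q.eval t = (derivative f).eval t := Multiplicity.eval_divByMonic_eq_eval_derivative hroot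
  have hqpos : 0 < q.eval t := by rw [hqt]; exact hup
  have hcont : Continuous fun x => q.eval x := q.continuous
  have hev : ∀ᶠ x in 𝓝 t, 0 < q.eval x := continuousAt_const.eventually_lt hcont.continuousAt hqpos
  obtain ⟨ε, hε, hεq⟩ := Metric.eventually_nhds_iff.1 hev
  obtain ⟨x, hx, hxd⟩ := exists_mem_Ioo_near_right hat hε
  have hfx : f.eval x < 0 := by
    have h : f.eval x = (x - t) * q.eval x := by rw [← hf, eval_mul, eval_sub, eval_X, eval_C]
    rw [h]
    exact mul_neg_of_neg_of_pos (by linarith [hx.2]) (hεq hxd)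
  -- intermediate value theorem on `[a, x]`
  have hcontf : ContinuousOn (fun y => f.eval y) (Set.Icc a x) := f.continuous.continuousOn
  have hmem : (0 : ℝ) ∈ Set.Icc (f.eval x) (f.eval a) := ⟨hfx.le, hfa.le⟩
  obtain ⟨s, hs, hfs⟩ := intermediate_value_Icc' hx.1.le hcontf hmem
  have hsa : s ≠ a := fun h => by rw [h] at hfs; exact hfa.ne' hfs
  have hsx : s ≠ x := fun h => by rw [h] at hfs; exact hfx.ne hfs
  exact ⟨s, lt_of_le_of_ne hs.1 (Ne.symm hsa), lt_of_lt_of_le (lt_of_le_of_ne hs.2 hsx) hx.2.le, hfs⟩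

/-- **Two positive roots with multiplicity.**  With `0 < a` in the situation above, `f` has at least two positive roots counted with
multiplicity. [folklore] -/
theorem two_le_countP_roots_pos_of_upcrossing (f : ℝ[X]) (hf : f ≠ 0) {a t : ℝ} (ha : 0 < a) (hat : a < t)
    (hfa : 0 < f.eval a) (hroot : f.eval t = 0) (hup : 0 < (derivative f).eval t) :
    2 ≤ f.roots.countP (fun x => 0 < x) := by
  classical
  obtain ⟨s, has, hst, hfs⟩ := exists_root_before_of_upcrossing f hat hfa hroot hup
  rw [Multiset.countP_eq_card_filter]
  have hs : s ∈ (f.roots.filter (fun x => 0 < x)).toFinset := by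
    rw [Multiset.mem_toFinset, Multiset.mem_filter]
    exact ⟨(mem_roots hf).2 hfs, lt_trans ha has⟩
  have ht : t ∈ (f.roots.filter (fun x => 0 < x)).toFinset := by
    rw [Multiset.mem_toFinset, Multiset.mem_filter]
    exact ⟨(mem_roots hf).2 hroot, lt_trans ha hat⟩
  have hsub : ({s, t} : Finset ℝ) ⊆ (f.roots.filter (fun x => 0 < x)).toFinset := by
    intro y hy
    rcases Finset.mem_insert.1 hy with h | h
    · rw [h]; exact hs
    · rw [Finset.mem_singleton.1 h]; exact ht
  have hcard : ({s, t} : Finset ℝ).card = 2 := Finset.card_pair (ne_of_lt hst)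
  calc 2 = ({s, t} : Finset ℝ).card := hcard.symm
    _ ≤ (f.roots.filter (fun x => 0 < x)).toFinset.card := Finset.card_le_card hsub
    _ ≤ Multiset.card (f.roots.filter (fun x => 0 < x)) := Multiset.toFinset_card_le _

/-- **At least two sign variations (Descartes).** [folklore] -/
theorem two_le_signVariations_of_upcrossing (f : ℝ[X]) (hf : f ≠ 0) {a t : ℝ} (ha : 0 < a) (hat : a < t)
    (hfa : 0 < f.eval a) (hroot : f.eval t = 0) (hup : 0 < (derivative f).eval t) :
    2 ≤ f.signVariations :=
  le_trans (two_le_countP_roots_pos_of_upcrossing f hf ha hat hfa hroot hup) f.roots_countP_pos_le_signVariations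

/-! ## §2 The revival lemma for lacunary symmetric pencils -/

section Pencil

variable {ι κ : Type} [Fintype ι] [Fintype κ]

/-- **THE REVIVAL LEMMA.**  `F(X) = ∑ₖ X^{dₖ}Sₖ`; `t > 0` with `F(t)u = 0`, `u ≠ 0`, Rayleigh `K`-nomial `P_u = ∑ₖ (uᵀSₖu)X^{dₖ}` with
`P_u′(t) > 0` (the root is an UP-crossing for `u`) and `P_u(a) > 0` at some scale `0 < a < t`.  Then `P_u` has a root in `(a, t)` and at
least two sign variations in its coefficient sequence. [folklore] -/
theorem revival_lemma (d : κ → ℕ) (S : κ → Matrix ι ι ℝ) {a t : ℝ} (ha : 0 < a) (hat : a < t) (u : ι → ℝ)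
    (hu : (∑ k, t ^ d k • S k) *ᵥ u = 0)
    (hpa : 0 < (∑ k, C (u ⬝ᵥ (S k *ᵥ u)) * (X : ℝ[X]) ^ d k).eval a)
    (hup : 0 < (derivative (∑ k, C (u ⬝ᵥ (S k *ᵥ u)) * (X : ℝ[X]) ^ d k)).eval t) :
    (∃ s, a < s ∧ s < t ∧ (∑ k, C (u ⬝ᵥ (S k *ᵥ u)) * (X : ℝ[X]) ^ d k).eval s = 0) ∧
      2 ≤ (∑ k, C (u ⬝ᵥ (S k *ᵥ u)) * (X : ℝ[X]) ^ d k).signVariations := by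
  set P := ∑ k, C (u ⬝ᵥ (S k *ᵥ u)) * (X : ℝ[X]) ^ d k with hP
  have hroot : P.eval t = 0 := by
    have h : u ⬝ᵥ ((∑ k, t ^ d k • S k) *ᵥ u) = 0 := by rw [hu, dotProduct_zero]
    rw [DefiniteMoments.form_eq_sum] at h
    rw [hP, eval_finsetSum, ← h]
    refine Finset.sum_congr rfl fun k _ => ?_
    rw [eval_mul, eval_C, eval_pow, eval_X, mul_comm]
  have hP0 : P ≠ 0 := fun h => by rw [h, eval_zero] at hpa; exact lt_irrefl 0 hpa
  exact ⟨exists_root_before_of_upcrossing P hat hpa hroot hup,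
    two_le_signVariations_of_upcrossing P hP0 ha hat hpa hroot hup⟩

end Pencil

end Inertia

end Summit.ValiantsHypothesis.ValiantsHypothesis.Theorems.LacunarySymmetroidMatrixDescartes
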